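import Summits.KontsevichZagierPeriods.KontsevichZagierPeriods.Theses.PhiFourHepp
import Summits.KontsevichZagierPeriods.KontsevichZagierPeriods.Theses.PhiFourLaboratory
import Summits.KontsevichZagierPeriods.KontsevichZagierPeriods.Theorems.PhiFourHeppKernelOfSummitR
import Literature.NumberTheory.Transcendental.KZKernelConjectureForms

/-!
# Crux `PhiFourKernelH` (stmt-KontsevichZagierPeriods-12286, route `PhiFourHepp`) — strategist census, SEAM FILE

Planner-folder evidence for `STRATEGY-CENSUS.md` (crux-strategist, unit
`cstrat-stmt-KontsevichZagierPeriods-12286-s2`). Nothing here is a line, a stub or a route item; no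
`sorry`. It CERTIFIES the logical facts the census relies on:

* §1 the exact position of the crux `K := PhiFourKernelH` (kernel form of the enlarged calculus
  `KZ^H = ⟨moves ∪ S_H⟩`): `summit → K` (landed, `kernelOfSummitR_proof`), `TropicalLifting → K → summit`
  (the route's `closes`), hence `TropicalLifting → (K ↔ summit)`; and `KZKernelConjecture → K`.
* §2 the two seam schemas every typed cut of `K` instantiates — SCHEMA T (an intermediate subgroup
  `ker eval ≤ J ≤ KZ^H`, 1 line) and SCHEMA W (witness / canceller, 2 lines) — and the generic
  "kernel modulo a relator scheme `S'` + `S'` derivable in `KZ^H`" cut (`K_of_scheme`,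
  `K_of_subscheme`: 3 lines), of which the registered line `Lines/birth.lean` (S_P ⊆ S_H by Hepp
  faithfulness) and the symmetry-scheme variant of the census are instances; plus the torsion detour
  (`K_of_rational_of_torsionFree`).
* §3 the sector reading: `summit ↔ PhiFourSector ∧ OffPhiFourSector` with
  `OffPhiFourSector := PhiFourSector → summit`; `K` follows from the pair by `kernelOfSummitR_proof`
  (2-line seam) — `K` is the route's OFF-SECTOR complement made unconditional by adjoining the
  sector's relators.
* §4 the negation schema: `K ↔` every additive invariant `θ : FormalRep →+ A` vanishing on the four
  move sets and on `S_H` vanishes on `ker eval`; a refutation of `K` is exactly such a `θ` separating one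
  kernel element (`not_K_of_invariant`).

References: [Kontsevich–Zagier 2001, §1.2 Conj. 1]; [Panzer 2022, Conj. 1.2, Thm. 1.1];
[Huber–Müller-Stach 2017, §13.2].
-/

noncomputable section

set_option linter.dupNamespace false

namespace Summit.KontsevichZagierPeriods.KontsevichZagierPeriods.Cruxes.PhiFourKernelH.Census

open Literature.NumberTheory.Transcendental
open Summit.KontsevichZagierPeriods.KontsevichZagierPeriods.Theses

/-- The union of the four move sets of the KZ calculus (rules 1a, 1b, 2, 3). [cite: KontsevichZagier2001, §1.2] -/
abbrev moves : Set KZ.FormalRep :=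
  KZ.domainAddRel ∪ KZ.integrandAddRel ∪ KZ.changeOfVariablesRel ∪ KZ.newtonLeibnizRel

/-- **The Hepp relator scheme `S_H`** — VERBATIM the set-builder inlined in the crux
`Theses.PhiFourHepp.PhiFourKernelH` (pairs of `φ⁴` parametric data with equal inlined Hepp bound).
[cite: Panzer2022, Prop. 3.2 and Conj. 1.2] -/
def heppRelators : Set Literature.NumberTheory.Transcendental.KZ.FormalRep :=
  {d : Literature.NumberTheory.Transcendental.KZ.FormalRep | ∃ (k₁ k₂ : ℕ) (E₁ : Fin (2*k₁+2) → Fin (k₁+2) × Fin (k₁+2)) (E₂ : Fin (2*k₂+2) → Fin (k₂+2) × Fin (k₂+2)) (r₁ : Literature.NumberTheory.Transcendental.KZ.IntegralRep (2*k₁+1)) (r₂ : Literature.NumberTheory.Transcendental.KZ.IntegralRep (2*k₂+1)), (∀ v, (Finset.univ.filter fun e => (E₁ e).1 = v ∨ (E₁ e).2 = v).card ≤ 4) ∧ (∀ v, (Finset.univ.filter fun e => (E₂ e).1 = v ∨ (E₂ e).2 = v).card ≤ 4) ∧ r₁.domain = {x | ∀ j, 0 < x j} ∧ Set.EqOn r₁.integrand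 (fun x => 1 / ((Matrix.fromBlocks (Matrix.diagonal (Fin.snoc x (1:ℝ) : Fin (2*k₁+2) → ℝ)) (Matrix.of fun (e : Fin (2*k₁+2)) (j : Fin (k₁+1)) => ((if (E₁ e).1 = j.succ then (1:ℝ) else 0) - (if (E₁ e).2 = j.succ then (1:ℝ) else 0))) (-(Matrix.of fun (e : Fin (2*k₁+2)) (j : Fin (k₁+1)) => ((if (E₁ e).1 = j.succ then (1:ℝ) else 0) - (if (E₁ e).2 = j.succ then (1:ℝ) else 0))).transpose) (0 : Matrix (Fin (k₁+1)) (Fin (k₁+1)) ℝ)).det) ^ 2) r₁.domain ∧ r₂.domain = {x | ∀ j, 0 < x j} ∧ Set.EqOn r₂.integrand (fun x => 1 / ((Matrix.fromBlocks (Matrix.diagonal (Fin.snoc x (1:ℝ) : Fin (2*k₂+2) → ℝ)) (Matrix.of fun (e : Fin (2*k₂+2)) (j : Fin (k₂+1)) => ((if (E₂ e).1 = j.succ then (1:ℝ) else 0) - (if (E₂ e).2 = j.succ then (1:ℝ) else 0))) (-(Matrix.of fun (e : Fin (2*k₂+2)) (j : Fin (k₂+1)) => ((if (E₂ e).1 =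 j.succ then (1:ℝ) else 0) - (if (E₂ e).2 = j.succ then (1:ℝ) else 0))).transpose) (0 : Matrix (Fin (k₂+1)) (Fin (k₂+1)) ℝ)).det) ^ 2) r₂.domain ∧ (∑ c : Fin (k₁+1) → Finset (Fin (2*k₁+2)), if ((∀ i : Fin (k₁+1), (c i).Nonempty ∧ (∀ e ∈ c i, (Matrix.of fun (p : {p // p ∈ (c i).erase e}) (v : Fin (k₁+2)) => ((if (E₁ p.1).1 = v then (1:ℚ) else 0) - (if (E₁ p.1).2 = v then (1:ℚ) else 0))).rank = (Matrix.of fun (p : {p // p ∈ c i}) (v : Fin (k₁+2)) => ((if (E₁ p.1).1 = v then (1:ℚ) else 0) - (if (E₁ p.1).2 = v then (1:ℚ) else 0))).rank) ∧ (c i).card - (Matrix.of fun (p : {p // p ∈ c i}) (v : Fin (k₁+2)) => ((if (E₁ p.1).1 = v then (1:ℚ) else 0) - (if (E₁ p.1).2 = v then (1:ℚ) else 0))).rank = i.val + 1) ∧ (∀ i j : Fin (k₁+1), i < j → c i ⊂ c j) ∧ c (Fin.last k₁) = Finset.univ) then ((c 0).card : ℚ) * (∏ i : Fin k₁, (((c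 i.succ).card : ℚ) - ((c i.castSucc).card : ℚ))) / (∏ i : Fin k₁, (((c i.castSucc).card : ℚ) - 2 * ((i.val : ℚ) + 1))) else 0) = (∑ c : Fin (k₂+1) → Finset (Fin (2*k₂+2)), if ((∀ i : Fin (k₂+1), (c i).Nonempty ∧ (∀ e ∈ c i, (Matrix.of fun (p : {p // p ∈ (c i).erase e}) (v : Fin (k₂+2)) => ((if (E₂ p.1).1 = v then (1:ℚ) else 0) - (if (E₂ p.1).2 = v then (1:ℚ) else 0))).rank = (Matrix.of fun (p : {p // p ∈ c i}) (v : Fin (k₂+2)) => ((if (E₂ p.1).1 = v then (1:ℚ) else 0) - (if (E₂ p.1).2 = v then (1:ℚ) else 0))).rank) ∧ (c i).card - (Matrix.of fun (p : {p // p ∈ c i}) (v : Fin (k₂+2)) => ((if (E₂ p.1).1 = v then (1:ℚ) else 0) - (if (E₂ p.1).2 = v then (1:ℚ) else 0))).rank = i.val + 1) ∧ (∀ i j : Fin (k₂+1), i < j → c i ⊂ c j) ∧ c (Fin.last k₂) = Finset.univ) then ((c 0).card : ℚ) * (∏ i : Fin k₂, (((c i.succ).card : ℚ) - ((c i.castSucc).card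 : ℚ))) / (∏ i : Fin k₂, (((c i.castSucc).card : ℚ) - 2 * ((i.val : ℚ) + 1))) else 0) ∧ d = Literature.NumberTheory.Transcendental.KZ.of r₁ - Literature.NumberTheory.Transcendental.KZ.of r₂}

/-- **`KZ^H`** = closure of the four move sets and `S_H`; definitionally the right-hand side of the crux. [cite: Panzer2022, Conj. 1.2] -/
def kzH : AddSubgroup KZ.FormalRep := AddSubgroup.closure (moves ∪ heppRelators)

/-- The crux read through the named vocabulary (definitional). [cite: KontsevichZagier2001, §1.2] -/
theorem K_iff : PhiFourHepp.PhiFourKernelH ↔ ∀ c : KZ.FormalRep, KZ.eval c = 0 → c ∈ kzH :=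
  Iff.rfl

/-! ## §1 Position of the crux -/

/-- `KZ.relations = ⟨moves⟩ ≤ KZ^H`. [folklore] -/
theorem relations_le_kzH : KZ.relations ≤ kzH :=
  AddSubgroup.closure_mono Set.subset_union_left

/-- The four move sets lie in `KZ^H`. [folklore] -/
theorem moves_subset_kzH : moves ⊆ (kzH : Set KZ.FormalRep) := fun _ hx =>
  AddSubgroup.subset_closure (Or.inl hx)

/-- `S_H ⊆ KZ^H`. [folklore] -/
theorem heppRelators_subset_kzH : heppRelators ⊆ (kzH : Set KZ.FormalRep) := fun _ hx =>
  AddSubgroup.subset_closure (Or.inr hx)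

/-- summit ⇒ K (LANDED: `kernelOfSummitR_proof`, Theorems/PhiFourHeppKernelOfSummitR.lean). [folklore] -/
theorem K_of_summit : KontsevichZagierPeriods → PhiFourHepp.PhiFourKernelH :=
  Summit.KontsevichZagierPeriods.PhiFourHepp.kernelOfSummitR_proof

/-- kernel form ⇒ K (monotonicity of closure). [folklore] -/
theorem K_of_kernelConjecture : KZKernelConjecture → PhiFourHepp.PhiFourKernelH :=
  fun h c hc => relations_le_kzH (h c hc)

/-- TropicalLifting ⇒ K ⇒ summit: the route's deciding theorem `closes`. [folklore] -/
theorem summit_of_K (hT : PhiFourHepp.TropicalLifting) (hK : PhiFourHepp.PhiFourKernelH) :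
    KontsevichZagierPeriods :=
  PhiFourHepp.closes hT hK

/-- Given the route's bet, the crux IS the summit. [folklore] -/
theorem K_iff_summit (hT : PhiFourHepp.TropicalLifting) :
    PhiFourHepp.PhiFourKernelH ↔ KontsevichZagierPeriods :=
  ⟨PhiFourHepp.closes hT, K_of_summit⟩

/-- Given the route's bet, the crux is the kernel form of Conjecture 1. [folklore] -/
theorem K_iff_kernelConjecture (hT : PhiFourHepp.TropicalLifting) :
    PhiFourHepp.PhiFourKernelH ↔ KZKernelConjecture :=
  (K_iff_summit hT).trans
    ⟨fun h => kzKernelConjecture_iff_isRational.mpr (KontsevichZagierPeriods_iff.mp h),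
     fun h => KontsevichZagierPeriods_iff.mpr (kzKernelConjecture_iff_isRational.mp h)⟩

/-- **Injectivity form.** `K` says exactly that membership in `KZ^H` depends only on the value
modulo values of `KZ^H`: the period map `FormalRep ⧸ KZ^H → ℝ ⧸ eval(KZ^H)` is injective. [cite: HuberMullerStach2017, Conj. 13.2.1] -/
theorem K_iff_injective_mod :
    PhiFourHepp.PhiFourKernelH ↔
      ∀ c h : KZ.FormalRep, h ∈ kzH → KZ.eval c = KZ.eval h → c ∈ kzH := by
  constructor
  · intro hK c h hh hv
    have hc : c = (c - h) + h := by abel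
    rw [hc]
    exact add_mem (hK _ (by rw [map_sub, hv, sub_self])) hh
  · intro h c hc
    exact h c 0 (zero_mem _) (by rw [hc, map_zero])

/-! ## §2 Seam schemas -/

/-- **SCHEMA T** (intermediate calculus / conservativity): `ker eval ≤ J` and `J ≤ KZ^H`. Seam: 1 line. [folklore] -/
theorem K_of_transitive (J : AddSubgroup KZ.FormalRep)
    (h₁ : ∀ c, KZ.eval c = 0 → c ∈ J) (h₂ : J ≤ kzH) : PhiFourHepp.PhiFourKernelH :=
  fun c hc => h₂ (h₁ c hc)

/-- **SCHEMA W** (witness / canceller / localisation): piece 1 produces a witness, piece 2 cashes it. Seam: 2 lines. [folklore] -/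
theorem K_of_exists_forall {ι : Type*} (R : KZ.FormalRep → ι → Prop)
    (h₁ : ∀ c, KZ.eval c = 0 → ∃ w, R c w) (h₂ : ∀ c w, R c w → c ∈ kzH) :
    PhiFourHepp.PhiFourKernelH := fun c hc => by
  obtain ⟨w, hw⟩ := h₁ c hc
  exact h₂ c w hw

/-- **The generic relator-scheme cut** ("Conjecture 1 modulo a scheme `S'`" ∧ "`S'` is derivable in
`KZ^H`") is SCHEMA T with `J = ⟨moves ∪ S'⟩`. Seam: 3 lines. [folklore] -/
theorem K_of_scheme (S' : Set KZ.FormalRep)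
    (h₁ : ∀ c, KZ.eval c = 0 → c ∈ AddSubgroup.closure (moves ∪ S'))
    (h₂ : S' ⊆ (kzH : Set KZ.FormalRep)) : PhiFourHepp.PhiFourKernelH :=
  K_of_transitive _ h₁ ((AddSubgroup.closure_le _).2 (Set.union_subset moves_subset_kzH h₂))

/-- **Sub-scheme cut**: `S' ⊆ S_H` (e.g. `S' = S_P` under Hepp faithfulness ⇒ = the registered line
`birth`; `S' =` pairs related by one of the five `φ⁴` symmetries under Panzer 2022 Thm 1.1 = the
census's symmetry variant). Seam: 1 more line. [cite: Panzer2022, Thm. 1.1 and Conj. 1.2] -/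
theorem K_of_subscheme (S' : Set KZ.FormalRep)
    (h₁ : ∀ c, KZ.eval c = 0 → c ∈ AddSubgroup.closure (moves ∪ S'))
    (h₂ : S' ⊆ heppRelators) : PhiFourHepp.PhiFourKernelH :=
  K_of_scheme S' h₁ fun _ hx => heppRelators_subset_kzH (h₂ hx)

/-- **Torsion detour** (birth's S1/S2 seam): the `ℚ`-linear kernel statement plus torsion-freeness of
`FormalRep ⧸ J` is SCHEMA W followed by SCHEMA T. Seam: 3 lines. [folklore] -/
theorem K_of_rational_of_torsionFree (J : AddSubgroup KZ.FormalRep)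
    (h₁ : ∀ c, KZ.eval c = 0 → ∃ N : ℕ, N ≠ 0 ∧ N • c ∈ J)
    (h₂ : ∀ (N : ℕ) c, N ≠ 0 → N • c ∈ J → c ∈ J) (h₃ : J ≤ kzH) :
    PhiFourHepp.PhiFourKernelH := fun c hc => by
  obtain ⟨N, hN, hNc⟩ := h₁ c hc
  exact h₃ (h₂ N c hN hNc)

/-- Conversely every piece of these schemas is NECESSARY with `J := kzH` (so the cuts are
equivalences, and the open piece `ker eval ≤ J` for `relations ≤ J ≤ kzH` is sandwiched exactly like `K`). [folklore] -/
theorem transitive_pieces_of_K (hK : PhiFourHepp.PhiFourKernelH) :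
    (∀ c, KZ.eval c = 0 → c ∈ kzH) ∧ kzH ≤ kzH :=
  ⟨hK, le_rfl⟩

/-! ## §3 The sector reading: `K` is the off-sector complement of the route, made unconditional -/

/-- **Off-sector complement** of the `φ⁴` sector: "if Conjecture 1 holds on the `φ⁴` parametric
sector (`PhiFourLaboratory.PhiFourSector`, the retired laboratory's target) then it holds". [cite: KontsevichZagier2001, §1.2] -/
def OffPhiFourSector : Prop :=
  PhiFourLaboratory.PhiFourSector → KontsevichZagierPeriods

/-- summit ⇒ the `φ⁴` sector (kernel form applied to `[r₁] − [r₂]`). [folklore] -/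
theorem phiFourSector_of_summit (h : KontsevichZagierPeriods) : PhiFourLaboratory.PhiFourSector := by
  intro k₁ k₂ E₁ E₂ _ _ r₁ r₂ _ _ _ _ hv
  have hK : KZKernelConjecture :=
    kzKernelConjecture_iff_isRational.mpr (KontsevichZagierPeriods_iff.mp h)
  exact hK _ (by rw [KZ.eval_of_sub_of, hv, sub_self])

/-- summit ⇒ off-sector complement (trivially). [folklore] -/
theorem offPhiFourSector_of_summit (h : KontsevichZagierPeriods) : OffPhiFourSector := fun _ => h

/-- summit ⇔ sector ∧ off-sector complement. [folklore] -/
theorem summit_iff_sector_and_off :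
    KontsevichZagierPeriods ↔ PhiFourLaboratory.PhiFourSector ∧ OffPhiFourSector :=
  ⟨fun h => ⟨phiFourSector_of_summit h, offPhiFourSector_of_summit h⟩, fun h => h.2 h.1⟩

/-- **The sector cut of `K`**: `PhiFourSector ∧ OffPhiFourSector → K`, seam 1 line THROUGH the
summit — it decomposes the summit, not `K`. [folklore] -/
theorem K_of_sector_and_off (hΦ : PhiFourLaboratory.PhiFourSector) (hO : OffPhiFourSector) :
    PhiFourHepp.PhiFourKernelH :=
  K_of_summit (hO hΦ)

/-- `K` ⇒ (TropicalLifting → OffPhiFourSector): with the sector's relators adjoined AS MOVES the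
off-sector complement needs no sector hypothesis. [folklore] -/
theorem off_of_K (hK : PhiFourHepp.PhiFourKernelH) (hT : PhiFourHepp.TropicalLifting) :
    OffPhiFourSector := fun _ => PhiFourHepp.closes hT hK

/-! ## §4 Negation schema: invariants -/

/-- Every additive invariant vanishing on the move sets and on `S_H` vanishes on `KZ^H`. [folklore] -/
theorem invariant_vanishes_on_kzH {A : Type*} [AddCommGroup A] (θ : KZ.FormalRep →+ A)
    (hθ : ∀ x ∈ moves ∪ heppRelators, θ x = 0) {c : KZ.FormalRep} (hc : c ∈ kzH) : θ c = 0 := by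
  have h : kzH ≤ θ.ker := (AddSubgroup.closure_le _).2 fun x hx => (AddMonoidHom.mem_ker).2 (hθ x hx)
  exact (AddMonoidHom.mem_ker).1 (h hc)

/-- **Refutation shape.** An additive invariant of formal representations that vanishes on the four
move sets and on every Hepp relator but not on some value-`0` combination refutes the crux. [folklore] -/
theorem not_K_of_invariant {A : Type*} [AddCommGroup A] (θ : KZ.FormalRep →+ A)
    (hθ : ∀ x ∈ moves ∪ heppRelators, θ x = 0) (c : KZ.FormalRep) (hc : KZ.eval c = 0)
    (hθc : θ c ≠ 0) : ¬ PhiFourHepp.PhiFourKernelH := fun hK =>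
  hθc (invariant_vanishes_on_kzH θ hθ (hK c hc))

/-- **Invariant completeness form of the crux**: `K` holds iff every additive invariant killed by the
moves and the Hepp relators kills `ker eval` (← : take the quotient map `FormalRep → FormalRep ⧸ KZ^H`). [folklore] -/
theorem K_iff_invariants :
    PhiFourHepp.PhiFourKernelH ↔
      ∀ (A : Type) [AddCommGroup A] (θ : KZ.FormalRep →+ A),
        (∀ x ∈ moves ∪ heppRelators, θ x = 0) → ∀ c, KZ.eval c = 0 → θ c = 0 := by
  constructor
  · intro hK A _ θ hθ c hc
    exact invariant_vanishes_on_kzH θ hθ (hK c hc)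
  · intro h c hc
    have h0 := h (KZ.FormalRep ⧸ kzH) (QuotientAddGroup.mk' kzH)
      (fun x hx => (QuotientAddGroup.eq_zero_iff x).2 (AddSubgroup.subset_closure hx)) c hc
    exact (QuotientAddGroup.eq_zero_iff c).1 h0


/-! ## §5 The period-coincidence scheme `S_P` and the core `K_P` of the registered line `birth`

`K_P := ker eval ≤ ⟨moves ∪ S_P⟩` ("Conjecture 1 modulo the φ⁴ period coincidences") is the core of
`Lines/birth.lean` (`S1 ∧ S2 ⇔ K_P`). We certify: `summit → K_P`; `K_P ∧ (S_P ⊆ S_H) → K` (the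
sub-scheme seam); `K_P ∧ PhiFourSectorP → summit` and `summit → PhiFourSectorP` — so `K_P` is
sandwiched exactly like `K` (summit-strength relative to the φ⁴ sector), i.e. it "remains the whole
crux"; and `S2` of birth (torsion-freeness of `FormalRep ⧸ K_P`'s subgroup) follows from `K_P`.
-/

/-- **The set of `φ⁴` parametric data** (verbatim from `Lines/birth.lean`). [cite: Panzer2022, §1 p. 4 and Prop. 3.2] -/
def phiFourData (k : ℕ) (E : Fin (2*k+2) → Fin (k+2) × Fin (k+2)) :
    Set (Literature.NumberTheory.Transcendental.KZ.IntegralRep (2*k+1)) :=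
  {r | (∀ v, (Finset.univ.filter fun e => (E e).1 = v ∨ (E e).2 = v).card ≤ 4) ∧ r.domain = {x | ∀ j, 0 < x j} ∧ Set.EqOn r.integrand (fun x => 1 / ((Matrix.fromBlocks (Matrix.diagonal (Fin.snoc x (1:ℝ) : Fin (2*k+2) → ℝ)) (Matrix.of fun (e : Fin (2*k+2)) (j : Fin (k+1)) => ((if (E e).1 = j.succ then (1:ℝ) else 0) - (if (E e).2 = j.succ then (1:ℝ) else 0))) (-(Matrix.of fun (e : Fin (2*k+2)) (j : Fin (k+1)) => ((if (E e).1 = j.succ then (1:ℝ) else 0) - (if (E e).2 = j.succ then (1:ℝ) else 0))).transpose) (0 : Matrix (Fin (k+1)) (Fin (k+1)) ℝ)).det) ^ 2) r.domain}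

/-- **The period-coincidence relator scheme `S_P`** (verbatim from `Lines/birth.lean`): differences of
`φ⁴` data with EQUAL VALUE. [cite: KontsevichZagier2001, §1.2] [cite: Panzer2022, Conj. 1.2] -/
def periodRelators : Set Literature.NumberTheory.Transcendental.KZ.FormalRep :=
  {d | ∃ (k₁ k₂ : ℕ) (E₁ : Fin (2*k₁+2) → Fin (k₁+2) × Fin (k₁+2)) (E₂ : Fin (2*k₂+2) → Fin (k₂+2) × Fin (k₂+2)) (r₁ : Literature.NumberTheory.Transcendental.KZ.IntegralRep (2*k₁+1)) (r₂ : Literature.NumberTheory.Transcendental.KZ.IntegralRep (2*k₂+1)), r₁ ∈ phiFourData k₁ E₁ ∧ r₂ ∈ phiFourData k₂ E₂ ∧ r₁.value = r₂.value ∧ d = Literature.NumberTheory.Transcendental.KZ.of r₁ - Literature.NumberTheory.Transcendental.KZ.of r₂}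

/-- **`KZ^P`** = closure of the moves and `S_P` (verbatim from `Lines/birth.lean`). [cite: KontsevichZagier2001, §1.2] -/
def kzP : AddSubgroup KZ.FormalRep := AddSubgroup.closure (moves ∪ periodRelators)

/-- **`K_P`**, the core of the registered line: Conjecture 1 modulo the φ⁴ period coincidences. [cite: KontsevichZagier2001, §1.2 Conjecture 1] -/
def KP : Prop := ∀ c : KZ.FormalRep, KZ.eval c = 0 → c ∈ kzP

/-- **The φ⁴ sector of Conjecture 1 in period-coincidence form** (= the retired laboratory's target
`PhiFourLaboratory.PhiFourSector` read through `phiFourData`): equal-value φ⁴ data are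
move-equivalent, i.e. `S_P ⊆ relations`. [cite: KontsevichZagier2001, §1.2 Conjecture 1] [cite: Panzer2022, Conj. 1.2] -/
def PhiFourSectorP : Prop := periodRelators ⊆ (KZ.relations : Set KZ.FormalRep)

/-- `S_P` is sound: its elements evaluate to `0`. [folklore] -/
theorem eval_eq_zero_of_mem_periodRelators {d : KZ.FormalRep} (hd : d ∈ periodRelators) :
    KZ.eval d = 0 := by
  obtain ⟨k₁, k₂, E₁, E₂, r₁, r₂, _, _, hv, rfl⟩ := hd
  rw [KZ.eval_of_sub_of, hv, sub_self]

/-- `KZ^P ≤ ker eval` (soundness of the moves and of `S_P`). [folklore] -/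
theorem kzP_le_ker : kzP ≤ KZ.eval.ker :=
  (AddSubgroup.closure_le _).2 (Set.union_subset
    (fun _ hx => (AddMonoidHom.mem_ker).2
      (KZ.relations_le_ker_eval_holds (AddSubgroup.subset_closure hx)))
    (fun _ hx => (AddMonoidHom.mem_ker).2 (eval_eq_zero_of_mem_periodRelators hx)))

/-- `relations ≤ KZ^P`. [folklore] -/
theorem relations_le_kzP : KZ.relations ≤ kzP :=
  AddSubgroup.closure_mono Set.subset_union_left

/-- summit ⇒ `K_P`. [folklore] -/
theorem KP_of_summit (h : KontsevichZagierPeriods) : KP := fun c hc =>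
  relations_le_kzP ((kzKernelConjecture_iff_isRational.mpr (KontsevichZagierPeriods_iff.mp h)) c hc)

/-- summit ⇒ the φ⁴ sector (period-coincidence form). [folklore] -/
theorem phiFourSectorP_of_summit (h : KontsevichZagierPeriods) : PhiFourSectorP := fun d hd =>
  (kzKernelConjecture_iff_isRational.mpr (KontsevichZagierPeriods_iff.mp h)) d
    (eval_eq_zero_of_mem_periodRelators hd)

/-- `K_P` ∧ φ⁴ sector ⇒ kernel form ⇒ summit: `K_P` is Conjecture 1 OFF the φ⁴ sector. Seam: SCHEMA T. [folklore] -/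
theorem summit_of_KP_of_sector (hK : KP) (hΦ : PhiFourSectorP) : KontsevichZagierPeriods := by
  have hle : kzP ≤ KZ.relations :=
    (AddSubgroup.closure_le _).2 (Set.union_subset (fun _ hx => AddSubgroup.subset_closure hx) hΦ)
  exact KontsevichZagierPeriods_iff.mpr
    (kzKernelConjecture_iff_isRational.mp fun c hc => hle (hK c hc))

/-- Hence summit ⇔ `K_P` ∧ φ⁴ sector. [folklore] -/
theorem summit_iff_KP_and_sector : KontsevichZagierPeriods ↔ KP ∧ PhiFourSectorP :=
  ⟨fun h => ⟨KP_of_summit h, phiFourSectorP_of_summit h⟩, fun h => summit_of_KP_of_sector h.1 h.2⟩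

/-- **Birth's seam, de-torsioned**: `K_P ∧ (S_P ⊆ S_H) → K` is the sub-scheme cut (4 lines in all). [cite: Panzer2022, Conj. 1.2] -/
theorem K_of_KP_of_subset (hK : KP) (hPH : periodRelators ⊆ heppRelators) :
    PhiFourHepp.PhiFourKernelH :=
  K_of_subscheme periodRelators hK hPH

/-- `K_P` already contains birth's S2 (torsion-freeness of `FormalRep ⧸ KZ^P`), by soundness of `KZ^P`. [folklore] -/
theorem torsionFree_of_KP (hK : KP) (N : ℕ) (c : KZ.FormalRep) (hN : N ≠ 0) (hNc : N • c ∈ kzP) :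
    c ∈ kzP := by
  have h0 : KZ.eval (N • c) = 0 := (AddMonoidHom.mem_ker).1 (kzP_le_ker hNc)
  rw [map_nsmul, nsmul_eq_mul, mul_eq_zero] at h0
  exact hK c (h0.resolve_left (by exact_mod_cast hN))

/-- …and birth's S1 with `N = 1`. [folklore] -/
theorem S1_of_KP (hK : KP) {n m : ℕ} (r : KZ.IntegralRep n) (r' : KZ.IntegralRep m)
    (hv : r.value = r'.value) :
    ∃ N : ℕ, N ≠ 0 ∧ N • (KZ.of r - KZ.of r') ∈ kzP :=
  ⟨1, one_ne_zero, by rw [one_nsmul]; exact hK _ (by rw [KZ.eval_of_sub_of, hv, sub_self])⟩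

end Summit.KontsevichZagierPeriods.KontsevichZagierPeriods.Cruxes.PhiFourKernelH.Census
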